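import Summits.NavierStokesRegularity.NavierStokesRegularity.Theorems.ExtremiserTransienceNearExtremalTransienceExtremiserLiouvilleConstantSpeedSlidePalinstrophyLimit
import Summits.NavierStokesRegularity.NavierStokesRegularity.Theorems.ExtremiserTransienceNearExtremalTransienceExtremiserLiouvilleConstantSpeedSlideKKT
import Summits.NavierStokesRegularity.NavierStokesRegularity.Theorems.ExtremiserTransienceNearExtremalTransienceExtremiserLiouvilleConstantSpeedHemisphere
import HarnessLib

/-!
# Crux `ExtremiserTransience.NearExtremalTransience` (stmt-NavierStokesRegularity-21883), line `extremiser_liouville`,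
# stub K1b — **(INEQ)₀: THE SLIDE INEQUALITY** `S·J₁(−φ_g) ≤ κ⋆²M²(∫|Dω|²_F·a₁(−φ_g) + ∫‖ω‖²·ĉ₁)` (record §13, R5)

`--supports stmt-NavierStokesRegularity-21883` (helper).  Author: prover seat `ns-el-k1b` (g9).  Record:
`Cruxes/NearExtremalTransience/Lines/extremiser_liouville_k1b_slide.md` §0–§1, §11–§13.

THE RESULT (`slideInequality`).  Let `v` be a constant-speed extended extremiser (`‖v‖ ≡ M`, `C^∞`, divergence free,
`‖Dv‖ ≤ B`, `D¹v, D²v ∈ L²`, `|S| = κ⋆M√Z√W`) with axis-normalised far field `c = (0,0,c₂)`, `‖c‖ = M`, `V = v − c`,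
and let `g` be a far LAYER PROFILE: `g ∈ C^∞`, `g, g′ ≥ 0`, `g…g‴` bounded, `g′ = g″ = g‴ = 0` off `[−T, T]`, the slab
`{|x₂| ≤ T}` square integrable for `V`, and `‖V‖² ≤ 2M²` on `{|x₂| ≤ T + h₀}` for some `h₀ > 0`.  Then the first
variation of the efficiency along the slide generator `φ_g = g∂₂V + g′V_h` satisfies
`S·J₁(−φ_g) ≤ κ⋆²M²·(∫|Dω|²_F · a₁(−φ_g) + ∫‖ω‖² · ĉ₁)`, where `J₁`, `a₁` are the stretching / enstrophy variations
and `ĉ₁` is the REGULARISED palinstrophy variation (only `D²V`; the `D³V`-looking part was handled by the discrete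
product rule with its favourable-sign remainder dropped).  PROOF: `slideKKT` (p727196) for `ψ_h = −h⁻¹φ̂_h`, every
`0 < h ≤ h₀`; `J₁(ψ_h) → J₁(−φ_g)` (p729005), `a₁(ψ_h) → a₁(−φ_g)` (p728224), `c₁(ψ_h) ≤ RHS_h → ĉ₁`
(…SlidePalinstrophyLimit), and `∫‖ω‖² ≥ 0`; pass to the limit.
NEXT (record §13 R6–R9): evaluate `a₁(−φ_g)` (`slideEnstrophyLaw_jet`, p721994) and `ĉ₁` by the pointwise identities
(Z)/(S) of §11, absorb ⇒ (DEC); jet kill (p722085); flat (§10); closing.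

WHAT THIS IS NOT: K1b is NOT proved; nothing here proves NS regularity. [folklore]
-/

noncomputable section

open Set Filter Topology MeasureTheory Metric Function InnerProductSpace
open scoped ENNReal NNReal Topology InnerProductSpace RealInnerProductSpace ContDiff
open Literature.Analysis.FluidPDE Literature.Analysis

namespace Summit.NavierStokesRegularity.NavierStokesRegularity.Theorems

-- the problem directory repeats the summit name (`NavierStokesRegularity/NavierStokesRegularity`)
set_option linter.dupNamespace false

namespace ExtremiserLiouville

open DepletionLadder.KStar

variable {v : EuclideanSpace ℝ (Fin 3) → EuclideanSpace ℝ (Fin 3)} {c : EuclideanSpace ℝ (Fin 3)} {g : ℝ → ℝ}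

/-- **(INEQ)₀ — THE SLIDE INEQUALITY** (record §13, R5).  For a constant-speed extended extremiser `v` with
axis-normalised far field `c` and a far layer profile `g` (hypotheses of `slideKKT`, the far-field condition on a layer
thickened by some `h₀ > 0`): with `φ_g = g∂₂V + g′V_h` (`V = v − c`) and the regularised palinstrophy variation
`ĉ₁ = −½∫g′|Dω|²_F − ∫Σᵢ⟪∂ᵢω, (∂₂R)bᵢ⟫ + ∫Σᵢ⟪∂ᵢω, (DK₁bᵢ)e₀ − (DK₀bᵢ)e₁⟫` (`R = D(curl(gV)) − gDω`, `Kⱼ = ∂ⱼ(g′V₂)`),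
**`S·J₁(−φ_g) ≤ κ⋆²M²·(∫|Dω|²_F · a₁(−φ_g) + ∫‖ω‖² · ĉ₁)`** — the limit `h → 0⁺` of `slideKKT` (`J₁`, `a₁` limits:
…SlideVariationLimit(J); `limsup c₁ ≤ ĉ₁`: …SlidePalinstrophyLimit).  Only `V, DV, D²V` enter. [folklore] -/
theorem slideInequality
    (hv : ContDiff ℝ ∞ v) (hdiv : VectorCalculus.IsDivFree v) {M B : ℝ} (hMpos : 0 < M)
    (hM : ∀ x, ‖v x‖ = M) (hB : ∀ x, ‖fderiv ℝ v x‖ ≤ B)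
    (h1 : ∫⁻ x, ‖iteratedFDeriv ℝ 1 v x‖ₑ ^ 2 < ⊤) (h2 : ∫⁻ x, ‖iteratedFDeriv ℝ 2 v x‖ₑ ^ 2 < ⊤)
    (hatt : |∫ x, ⟪curl v x, fderiv ℝ v x (curl v x)⟫| = (sInf {κ : ℝ | (∀ (v : EuclideanSpace ℝ (Fin 3) → EuclideanSpace ℝ (Fin 3)) (M B : ℝ), ContDiff ℝ (⊤ : ℕ∞) v → Literature.Analysis.FluidPDE.VectorCalculus.IsDivFree v → (∀ x, ‖v x‖ ≤ M) → (∀ x, ‖fderiv ℝ v x‖ ≤ B) → (∫⁻ x, ‖iteratedFDeriv ℝ 0 v x‖ₑ ^ 2 < ⊤) → (∫⁻ x, ‖iteratedFDeriv ℝ 1 v x‖ₑ ^ 2 < ⊤) → (∫⁻ x, ‖iteratedFDeriv ℝ 2 v x‖ₑ ^ 2 < ⊤) → |∫ x, ⟪Literature.Analysis.FluidPDE.curl v x, fderiv ℝ v x (Literature.Analysis.FluidPDE.curl v x)⟫_ℝ| ≤ κ * M * Real.sqrt (∫ x, ‖Literature.Analysis.FluidPDE.curl v x‖ ^ 2) *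 Real.sqrt (∫ x, Literature.Analysis.FluidPDE.frobeniusNormSq (fderiv ℝ (Literature.Analysis.FluidPDE.curl v) x)))}) * M * Real.sqrt (∫ x, ‖curl v x‖ ^ 2) * Real.sqrt (∫ x, frobeniusNormSq (fderiv ℝ (curl v) x)))
    (hc0 : c 0 = 0) (hc1 : c 1 = 0) (hcM : ‖c‖ = M)
    (hg : ContDiff ℝ ∞ g) {T K0 K1 K2 K3 : ℝ}
    (hK0 : ∀ s, |g s| ≤ K0) (hK1 : ∀ s, |deriv g s| ≤ K1) (hK2 : ∀ s, |deriv (deriv g) s| ≤ K2)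
    (hK3 : ∀ s, |deriv (deriv (deriv g)) s| ≤ K3)
    (hT1 : ∀ s, T < |s| → deriv g s = 0) (hT2 : ∀ s, T < |s| → deriv (deriv g) s = 0)
    (hT3 : ∀ s, T < |s| → deriv (deriv (deriv g)) s = 0)
    (hg0 : ∀ s, 0 ≤ g s) (hγ0 : ∀ s, 0 ≤ deriv g s)
    (hslab : Integrable (fun x => {x : EuclideanSpace ℝ (Fin 3) | |x 2| ≤ T}.indicator (fun x => ‖v x - c‖ ^ 2) x) volume)
    {h₀ : ℝ} (hh₀ : 0 < h₀) (hfar : ∀ x : EuclideanSpace ℝ (Fin 3), |x 2| ≤ T + h₀ → ‖v x - c‖ ^ 2 ≤ 2 * M ^ 2) :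
    (∫ x, ⟪curl v x, fderiv ℝ v x (curl v x)⟫) *
        (∫ x, (⟪curl (fun y : EuclideanSpace ℝ (Fin 3) => -(g (y 2) • fderiv ℝ v y (EuclideanSpace.single (2 : Fin 3) (1 : ℝ)) + deriv g (y 2) • (v y - c - (v y - c) 2 • EuclideanSpace.single (2 : Fin 3) (1 : ℝ)))) x, fderiv ℝ v x (curl v x)⟫ + ⟪curl v x, fderiv ℝ (fun y : EuclideanSpace ℝ (Fin 3) => -(g (y 2) • fderiv ℝ v y (EuclideanSpace.single (2 : Fin 3) (1 : ℝ)) + deriv g (y 2) • (v y - c - (v y - c) 2 • EuclideanSpace.single (2 : Fin 3) (1 : ℝ)))) x (curl v x)⟫ + ⟪curl v x, fderiv ℝ v x (curl (fun y : EuclideanSpace ℝ (Fin 3) => -(g (y 2) • fderiv ℝ v y (EuclideanSpace.single (2 : Fin 3) (1 : ℝ)) + deriv g (y 2) • (v y - c - (v y - c) 2 • EuclideanSpace.single (2 : Fin 3) (1 : ℝ)))) x)⟫)) ≤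
      (sInf {κ : ℝ | (∀ (v : EuclideanSpace ℝ (Fin 3) → EuclideanSpace ℝ (Fin 3)) (M B : ℝ), ContDiff ℝ (⊤ : ℕ∞) v → Literature.Analysis.FluidPDE.VectorCalculus.IsDivFree v → (∀ x, ‖v x‖ ≤ M) → (∀ x, ‖fderiv ℝ v x‖ ≤ B) → (∫⁻ x, ‖iteratedFDeriv ℝ 0 v x‖ₑ ^ 2 < ⊤) → (∫⁻ x, ‖iteratedFDeriv ℝ 1 v x‖ₑ ^ 2 < ⊤) → (∫⁻ x, ‖iteratedFDeriv ℝ 2 v x‖ₑ ^ 2 < ⊤) → |∫ x, ⟪Literature.Analysis.FluidPDE.curl v x, fderiv ℝ v x (Literature.Analysis.FluidPDE.curl v x)⟫_ℝ| ≤ κ * M * Real.sqrt (∫ x, ‖Literature.Analysis.FluidPDE.curl v x‖ ^ 2) * Real.sqrt (∫ x, Literature.Analysis.FluidPDE.frobeniusNormSq (fderiv ℝ (Literature.Analysis.FluidPDE.curl v) x)))}) ^ 2 * M ^ 2 *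
        ((∫ x, frobeniusNormSq (fderiv ℝ (curl v) x)) * (∫ x, ⟪curl v x, curl (fun y : EuclideanSpace ℝ (Fin 3) => -(g (y 2) • fderiv ℝ v y (EuclideanSpace.single (2 : Fin 3) (1 : ℝ)) + deriv g (y 2) • (v y - c - (v y - c) 2 • EuclideanSpace.single (2 : Fin 3) (1 : ℝ)))) x⟫) +
          (∫ x, ‖curl v x‖ ^ 2) *
          (-((1 / 2) * ∫ x, deriv g (x 2) * frobeniusNormSq (fderiv ℝ (curl v) x)) -
          (∫ x, ∑ i : Fin 3, ⟪fderiv ℝ (curl v) x (EuclideanSpace.basisFun (Fin 3) ℝ i),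
            (fderiv ℝ (fun y : EuclideanSpace ℝ (Fin 3) => fderiv ℝ (curl (fun z : EuclideanSpace ℝ (Fin 3) => g (z 2) • (v z - c))) y - g (y 2) • fderiv ℝ (curl v) y) x (EuclideanSpace.single (2 : Fin 3) (1 : ℝ))) (EuclideanSpace.basisFun (Fin 3) ℝ i)⟫) +
          ∫ x, ∑ i : Fin 3, ⟪fderiv ℝ (curl v) x (EuclideanSpace.basisFun (Fin 3) ℝ i),
            (fderiv ℝ (fun y : EuclideanSpace ℝ (Fin 3) => fderiv ℝ (fun z : EuclideanSpace ℝ (Fin 3) => deriv g (z 2) * (v z - c) 2) y (EuclideanSpace.single (1 : Fin 3) (1 : ℝ))) x (EuclideanSpace.basisFun (Fin 3) ℝ i)) • EuclideanSpace.single (0 : Fin 3) (1 : ℝ) -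
              (fderiv ℝ (fun y : EuclideanSpace ℝ (Fin 3) => fderiv ℝ (fun z : EuclideanSpace ℝ (Fin 3) => deriv g (z 2) * (v z - c) 2) y (EuclideanSpace.single (0 : Fin 3) (1 : ℝ))) x (EuclideanSpace.basisFun (Fin 3) ℝ i)) • EuclideanSpace.single (1 : Fin 3) (1 : ℝ)⟫)) := by
  -- the residue field `V = v − c`
  have hVs : ContDiff ℝ ∞ (fun y => v y - c) := hv.sub contDiff_const
  have hv1 : ContDiff ℝ 1 v := hv.of_le (WithTop.coe_le_coe.mpr le_top)
  have hVk : ∀ k : ℕ, k ≠ 0 → (∫⁻ x, ‖iteratedFDeriv ℝ k v x‖ₑ ^ 2 < ⊤) →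
      ∫⁻ x, ‖iteratedFDeriv ℝ k (fun y => v y - c) x‖ₑ ^ 2 < ⊤ := by
    intro k hk hkv
    have e : (fun x => ‖iteratedFDeriv ℝ k (fun y => v y - c) x‖ₑ ^ 2) = fun x => ‖iteratedFDeriv ℝ k v x‖ₑ ^ 2 := by
      funext x; rw [iteratedFDeriv_sub_const_of_ne hv c hk]
    rw [e]; exact hkv
  have hV1 := hVk 1 one_ne_zero h1
  have hV2 := hVk 2 two_ne_zero h2
  have hcurl : curl (fun y => v y - c) = curl v := curl_sub_const v c
  -- enstrophy is finite
  have hD1 : Integrable (fun x => ‖iteratedFDeriv ℝ 1 v x‖ ^ 2) (volume : Measure (EuclideanSpace ℝ (Fin 3))) :=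
    integrable_sq_norm_of_lintegral (hv.continuous_iteratedFDeriv (WithTop.coe_le_coe.mpr le_top)) h1
  have mω : MemLp (curl v) 2 (volume : Measure (EuclideanSpace ℝ (Fin 3))) :=
    memLp_two_of_norm_le_mul (K := 4) (continuous_curl hv1) (hv.continuous_iteratedFDeriv (WithTop.coe_le_coe.mpr le_top))
      hD1 fun x => by
        have := norm_iteratedFDeriv_curl_le_four hv 0 x
        rwa [norm_iteratedFDeriv_zero] at this
  have hZ : Integrable (fun x => ‖curl v x‖ ^ 2) (volume : Measure (EuclideanSpace ℝ (Fin 3))) := integrable_sq_of_memLp_two mω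
  -- the three limits and the palinstrophy bound, for the slide data `V = v − c`
  have LJ := tendsto_firstVar_stretching_slideQuotient (V := fun y => v y - c) hv1 hB hZ hVs hg hK0 hK1 hK2 hK3 hT1 hT2 hT3
    hV1 hV2 hslab
  have La := tendsto_firstVar_enstrophy_slideQuotient (V := fun y => v y - c) hv1 hZ hVs hg hK0 hK1 hK2 hK3 hT1 hT2 hT3
    hV1 hV2 hslab
  have Lc := tendsto_palinstrophy_slideQuotient_rhs (V := fun y => v y - c) hVs hg hK1 hK2 hK3 hT2 hT3 hV1 hV2 hslab
  have Hc := fun (h : ℝ) (hh : 0 < h) =>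
    palinstrophy_slideQuotient_le' (V := fun y => v y - c) hVs hg hK0 hK1 hK2 hK3 hT2 hT3 hg0 hV1 hV2 hslab hh
  simp only [hcurl, fderiv_sub_const] at LJ La Lc Hc
  -- signs of the coefficients
  have hE : 0 ≤ ∫ x, ‖curl v x‖ ^ 2 := integral_nonneg fun x => sq_nonneg _
  have hκ : 0 ≤ (sInf {κ : ℝ | (∀ (v : EuclideanSpace ℝ (Fin 3) → EuclideanSpace ℝ (Fin 3)) (M B : ℝ), ContDiff ℝ (⊤ : ℕ∞) v → Literature.Analysis.FluidPDE.VectorCalculus.IsDivFree v → (∀ x, ‖v x‖ ≤ M) → (∀ x, ‖fderiv ℝ v x‖ ≤ B) → (∫⁻ x, ‖iteratedFDeriv ℝ 0 v x‖ₑ ^ 2 < ⊤) → (∫⁻ x, ‖iteratedFDeriv ℝ 1 v x‖ₑ ^ 2 < ⊤) → (∫⁻ x, ‖iteratedFDeriv ℝ 2 v x‖ₑ ^ 2 < ⊤) → |∫ x, ⟪Literature.Analysis.FluidPDE.curl v x, fderiv ℝ v x (Literature.Analysis.FluidPDE.curl v x)⟫_ℝ| ≤ κ * M * Real.sqrt (∫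 x, ‖Literature.Analysis.FluidPDE.curl v x‖ ^ 2) * Real.sqrt (∫ x, Literature.Analysis.FluidPDE.frobeniusNormSq (fderiv ℝ (Literature.Analysis.FluidPDE.curl v) x)))}) ^ 2 * M ^ 2 := by positivity
  -- `0 < h < h₀` eventually
  have hev : ∀ᶠ h : ℝ in 𝓝[>] 0, 0 < h ∧ h < h₀ := by
    have h1' : ∀ᶠ h : ℝ in 𝓝[>] 0, h < h₀ := mem_nhdsWithin_of_mem_nhds (Iio_mem_nhds hh₀)
    exact (eventually_mem_nhdsWithin.and h1').mono fun h hh => ⟨hh.1, hh.2⟩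
  refine le_of_tendsto_of_tendsto (LJ.const_mul _) (((La.const_mul _).add (Lc.const_mul _)).const_mul _) ?_
  filter_upwards [hev] with h hh
  obtain ⟨hpos, hlt⟩ := hh
  have hfar' : ∀ x : EuclideanSpace ℝ (Fin 3), |x 2| ≤ T + h → ‖v x - c‖ ^ 2 ≤ 2 * M ^ 2 :=
    fun x hx => hfar x (hx.trans (by linarith))
  have k := slideKKT hv hdiv hMpos hM hB h1 h2 hatt hc0 hc1 hcM hg hK0 hK1 hK2 hK3 hT1 hT2 hT3 hg0 hγ0 hslab hpos hfar'
  exact k.trans (mul_le_mul_of_nonneg_left (add_le_add le_rfl (mul_le_mul_of_nonneg_left (Hc h hpos) hE)) hκ)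

end ExtremiserLiouville

end Summit.NavierStokesRegularity.NavierStokesRegularity.Theorems

end
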